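import Literature.MathematicalPhysics.QuantumFieldTheory.Balaban1983to89.T4CountHorizon

/-!
# Balaban T⁴ spine, estimate NE7b (node U5c, COUNT member P1): LATE MERGERS WITH AN OVERDUE PARTNER under the cell's
# healing convention [CONV-D] — part 1 of 4: the padded life geometry, the merger-padded bank, `ConsistentTH`, `FreshT`

Cell `pub-balaban`, lineage `b2b-balaban-t4-ne7b-p1` (generation 17), self-row `T4-U5c.E-NE7b-LATEMERGE-K*`; the
located residual (H1) of GAPS G-ne7bp1g16-1 of the lineage's `T4CountHorizon` (Literature-side leaf p194475, frozen,
imported BY NAME).  Summits-side NEW WORK (LEAN PLACEMENT RULE 2026-08-19: `Literature/` holds only published results;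
this is the cell's own bookkeeping and quotes print for CONTEXT only): tree
`Summits/QuantumFields/BalabanUV/T4Continuum/Support/LateMergers{,Span,Banking,Count}.lean`, ONE namespace
`Summit.QuantumFields.BalabanUV.T4Continuum.LateMergers`, part k+1 imports part k only.

HONEST FRAMING.  Rung (B)+1 of the FINITE-VOLUME T⁴ continuum programme: bookkeeping over the lineage's OWN typed
ledger of persistent large-field histories (`T4PersistenceDictionary.Gen`, `T4TaggedShapeBanking`, `T4CountHorizon`).
NOT infinite volume, NOT a mass gap, NOT the Clay problem, NOT a proof of NE7b; nothing of Bałaban's expansion is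
asserted; `BetaPertH` / (B) / (B^μ) are not involved (upstream of the term families, displayed by name elsewhere).
HONEST DEPENDENCY (cell, verbatim): continuum YM on T⁴ ⇐ BetaPertH ∧ nine spine estimates (0/9 proved); BetaPertH ⇐
(D1) ∧ (D4) ∧ CAP+tail; G-an2-4 gates asym, D1 and NE2/3/4.

THE RESIDUAL (H1) AND ITS ERRATUM.  Under [CONV-D] (RULING R-ηW, `t4/T4-REF-U5.md` §19; R-ηW-7 clause verbatim:
«print-literal except: no complete ℝ at the N_W + 1 youngest levels of either run (cell convention R-ηW)») complete ℝ
acts only at steps `≤ K − D`, `D := N_W + 1` a CONSTANT; a component whose (true) reach exceeds `K − D` is never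
healed (OVERDUE) and is still a region at every later step `≤ K`, so a MERGER may join it at a step `t ≥ reach` — which
the merger clause `(sh e).step < X.reach` of `T4TaggedShapeBanking.ConsistentT` and the overlap clause of
`T4PersistenceDictionary.Gen.WF` both refuse (witnesses `Sanity.Zl_not_consistentT`, `Sanity.Zl_not_wf`, part 2).
ERRATUM to G-ne7bp1g16-1 as filed: the clause «`(sh e).step < max (X.reach) (K − D + 1)`» proposed there relaxes
NOTHING (when `X.reach > K − D` it IS `t < X.reach`); the typed clause is `t < X.reach ∨ K − D < X.reach`.  The gen-16
draft hypothesis «`D ≤ C.n₁ + 1`» is NOT used (it is not automatic: N_W is unrelated to n₁): instead a merger-shaped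
label BANKS `D` more steps (`bankW`), paid K-freely by the merger surplus (part 3, `+ κ₁·D` in `HmH`).

CONTENT (part 1; every declaration [folklore], sorry-free, standard axioms).  §1 `padW W D e := W e + D`, used ONLY
as LIFE GEOMETRY (`Gen.reach`, `Gen.WF`, `life`, `lifeCost` are read over `padW`; costs, placements, renewal timing
and the merger extension keep the TRUE table `dictWT`), `reach_add_le_reach_padW`; `bankW sh R n₁ D e := dictWT e +
D·[kind e = 2]` with `bankW_kind0/1/2`, `bankW_zero`; `ConsistentTH sh C K R D` = `ConsistentT` VERBATIM except (i) a
renewal acts while `h + 1 ≤ K − D`, (ii) each merger partner is PENDING (`t < reach`) OR OVERDUE (`K − D < reach`);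
invariants `rootStep_lt_reach`, `root_spec`, `absorbed_spec`; the DOWNGRADE `consistentT_of_reach_le` (true reach
`≤ K − D` ⇒ `ConsistentT`) and `renew_consistentT`; TIGHTNESS `consistentTH_zero_iff` (`D = 0` ⇔ `ConsistentT`).
§2 `FreshT` (labels new where chained, partners' label sets disjoint — the label half of `Gen.WF`; the timing half is
DERIVED), `FreshT.of_wf`, `wf_of_consistentT_freshT` (`ConsistentT ∧ FreshT ⇒ WF` for the true table),
`ConsistentTH.wf_padW` (`ConsistentTH ∧ FreshT ⇒ WF` over `padW`).  Parts 2–4: placement / support / span + sanity;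
`Banking` inhabited + one infrared threshold; bridge, seam and END TO END
(`exists_irThreshold_relWeightBound_canon_lateMergers` = the statement of
`T4CountHorizon.exists_irThreshold_relWeightBound_canon_horizon` with the labelling binder relaxed to
`ConsistentTH ∧ FreshT ∧ K − D < reach` and the padded life cost, SAME budget / rates / condition).

ABSOLUTE RULE.  No internally-minted statement enters as a cited fact: 0 `[cite:]` tags, every hypothesis of every
theorem is a displayed binder; the manuscripts under audit (B15 = [Balaban1989LargeFieldI], B16 =
[Balaban1989LargeFieldII]; (1.79)–(1.89) pp. 383–387, (2.5)/(2.7)/(2.9) p. 361 of B14 = [Balaban1988RenormLattice])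
appear in docstrings as CONTEXT only, never as facts; programme-internal claims are not cited.  NOT PRINTED: [CONV-D],
the ledger, the banks and every inequality here are the cell's MODEL of print's procedure, handed to the (ID) owner
(GAPS G-ne7bp1g9-1) as the target of an identification nobody in the cell asserts.
-/

namespace Summit.QuantumFields.BalabanUV.T4Continuum.LateMergers

open Finset
open Literature.MathematicalPhysics.QuantumFieldTheory.Balaban1983to89
open T4PersistenceDictionary T4PersistentHistoryCount T4BankedInduction T4PrintedShapeBanking
open T4WeightBudget T4GlobalDenominator T4LiveClassFibration T4LiveStructureGas T4LiveGasToTerms T4RecordPriceSeam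
open T4PartnerMultiplicity T4BranchingRecordsGas T4TaggedShapeBanking T4CanonicalMenus T4CountHorizon

noncomputable section

/-! ## §1 The padded life geometry, the merger-padded bank table, consistency with late mergers -/

section Pad

variable {ε : Type*}

/-- **THE PADDED WINDOW TABLE** `padW W D e = W e + D` — used ONLY as LIFE GEOMETRY (`Gen.reach`, `Gen.WF`, `life`,
`lifeCost` are read over `padW W D`): every pending life is read `D` steps longer, so that a merger performed up to `D`
steps after a partner's true reach still joins OVERLAPPING (padded) lives.  Costs, placements, renewal timing and the
merger extension keep the TRUE table `W`. [folklore] -/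
def padW (W : ε → ℕ) (D : ℕ) : ε → ℕ := fun e => W e + D

/-- the padded table at a label [folklore] -/
@[simp] theorem padW_apply (W : ε → ℕ) (D : ℕ) (e : ε) : padW W D e = W e + D := rfl

/-- no padding: `padW W 0 = W` [folklore] -/
theorem padW_zero (W : ε → ℕ) : padW W 0 = W := rfl

/-- the padded reach is at least the true reach plus `D` (equality on births and renewals). [folklore] -/
theorem reach_add_le_reach_padW (W : ε → ℕ) (D : ℕ) : ∀ G : Gen ε, G.reach W + D ≤ G.reach (padW W D)
  | Gen.born b j => by simp only [Gen.reach_born, padW_apply]; omega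
  | Gen.renew G e h => by simp only [Gen.reach_renew, padW_apply]; omega
  | Gen.merge X Y e => by
      have hX := reach_add_le_reach_padW W D X
      have hY := reach_add_le_reach_padW W D Y
      simp only [Gen.reach_merge, padW_apply]
      omega

/-- the padded reach is at least the true reach [folklore] -/
theorem reach_le_reach_padW (W : ε → ℕ) (D : ℕ) (G : Gen ε) : G.reach W ≤ G.reach (padW W D) :=
  le_trans (Nat.le_add_right _ _) (reach_add_le_reach_padW W D G)

/-- **THE MERGER-PADDED BANK TABLE**: a label banks `κ₁` per step of its TRUE window, and a merger-shaped label banks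
`D` steps more (`dictWT e + D` on kind `2`, `dictWT e` on kinds `0`, `1`) — the partner age NOT covered by window credits
when a merger is performed after the horizon is charged to the merger's own surplus (`mergeTH_pay_holds`). [folklore] -/
def bankW (sh : ε → PEv) (R : ℕ → ℕ) (n₁ D : ℕ) : ε → ℕ :=
  fun e => dictWT sh R n₁ e + if (sh e).kind = 2 then D else 0

section BankLemmas

variable {sh : ε → PEv} {R : ℕ → ℕ} {n₁ D : ℕ} {e : ε}

/-- a birth-shaped label banks its window [folklore] -/
theorem bankW_kind0 (h : (sh e).kind = 0) : bankW sh R n₁ D e = dictWT sh R n₁ e := by simp [bankW, h]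
/-- a renewal-shaped label banks its window [folklore] -/
theorem bankW_kind1 (h : (sh e).kind = 1) : bankW sh R n₁ D e = dictWT sh R n₁ e := by simp [bankW, h]
/-- a merger-shaped label banks its window and the horizon [folklore] -/
theorem bankW_kind2 (h : (sh e).kind = 2) : bankW sh R n₁ D e = dictWT sh R n₁ e + D := by simp [bankW, h]

/-- no padding: `bankW … 0 = dictWT …` [folklore] -/
theorem bankW_zero (sh : ε → PEv) (R : ℕ → ℕ) (n₁ : ℕ) : bankW sh R n₁ 0 = dictWT sh R n₁ := by
  funext e; simp [bankW]

end BankLemmas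

variable (sh : ε → PEv) (C : T4PrintedShapeBanking.Consts) (K : ℕ) (R : ℕ → ℕ) (D : ℕ)

/-- **CONSISTENT TAGGED GENEALOGIES WITH LATE MERGERS** (`ConsistentTH sh C K R D`; at `D = 0` it IS
`T4TaggedShapeBanking.ConsistentT`, `consistentTH_zero_iff`): `ConsistentT` VERBATIM except (i) a renewal acts at
readiness `h + 1 = reach` only while `h + 1 ≤ K − D` (the cell's [CONV-D]: no complete ℝ above the horizon `K − D`),
and (ii) a merger at a step `t ≤ K` asks of each partner EITHER `t < reach` (pending, as before) OR `K − D < reach`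
(OVERDUE under [CONV-D]: never healed, hence still a region at every step `≤ K`). [folklore] -/
def ConsistentTH : Gen ε → Prop
  | Gen.born b j => (sh b).kind = 0 ∧ (sh b).step = j ∧ j ≤ K
  | Gen.renew G e h => ConsistentTH G ∧ (sh e).kind = 1 ∧ (sh e).step = h + 1 ∧
      h + 1 = G.reach (dictWT sh R C.n₁) ∧ h + 1 ≤ K - D
  | Gen.merge X Y e => ConsistentTH X ∧ ConsistentTH Y ∧ (sh e).kind = 2 ∧
      X.rootStep ≤ (sh e).step ∧
        ((sh e).step < X.reach (dictWT sh R C.n₁) ∨ K - D < X.reach (dictWT sh R C.n₁)) ∧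
      Y.rootStep ≤ (sh e).step ∧
        ((sh e).step < Y.reach (dictWT sh R C.n₁) ∨ K - D < Y.reach (dictWT sh R C.n₁)) ∧
      (sh e).step ≤ K

variable {sh C K R D}

/-- the root is born strictly before the (true) reach. [folklore] -/
theorem ConsistentTH.rootStep_lt_reach :
    ∀ {G : Gen ε}, ConsistentTH sh C K R D G → G.rootStep < G.reach (dictWT sh R C.n₁)
  | Gen.born b j, hc => by
      simp only [ConsistentTH] at hc
      obtain ⟨hk, -, -⟩ := hc
      simp only [Gen.rootStep_born, Gen.reach_born]
      rw [dictWT_kind0 hk]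
      omega
  | Gen.renew G e h, hc => by
      simp only [ConsistentTH] at hc
      obtain ⟨hG, -, -, hr, -⟩ := hc
      have := ConsistentTH.rootStep_lt_reach hG
      simp only [Gen.rootStep_renew, Gen.reach_renew]
      omega
  | Gen.merge X Y e, hc => by
      simp only [ConsistentTH] at hc
      obtain ⟨hX, -, -, -, -, -, -, -⟩ := hc
      have := ConsistentTH.rootStep_lt_reach hX
      simp only [Gen.rootStep_merge, Gen.reach_merge]
      omega

/-- the root is born no later than the reach. [folklore] -/
theorem ConsistentTH.rootStep_le_reach {G : Gen ε} (hc : ConsistentTH sh C K R D G) :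
    G.rootStep ≤ G.reach (dictWT sh R C.n₁) :=
  (ConsistentTH.rootStep_lt_reach hc).le

/-- the root of a consistent tagged genealogy has birth shape, at `rootStep`. [folklore] -/
theorem ConsistentTH.root_spec :
    ∀ {G : Gen ε}, ConsistentTH sh C K R D G → (sh G.root).kind = 0 ∧ (sh G.root).step = G.rootStep
  | Gen.born b j, hc => by
      simp only [ConsistentTH] at hc
      exact ⟨by simpa using hc.1, by simpa using hc.2.1⟩
  | Gen.renew G e h, hc => by
      simp only [ConsistentTH] at hc
      simpa using ConsistentTH.root_spec hc.1
  | Gen.merge X Y e, hc => by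
      simp only [ConsistentTH] at hc
      obtain ⟨hX, hY, -⟩ := hc
      have h1 := ConsistentTH.root_spec hX
      have h2 := ConsistentTH.root_spec hY
      rw [root_merge, Gen.rootStep_merge]
      split_ifs with h
      · exact ⟨h1.1, by rw [h1.2, min_eq_left h]⟩
      · exact ⟨h2.1, by rw [h2.2, min_eq_right (not_le.mp h).le]⟩

/-- the absorbed root of a consistent merger has birth shape, no later than the merger step and no later than the later
partner reach. [folklore] -/
theorem ConsistentTH.absorbed_spec {X Y : Gen ε} {e : ε} (hc : ConsistentTH sh C K R D (Gen.merge X Y e)) :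
    (sh (absorbed X Y)).kind = 0 ∧ (sh (absorbed X Y)).step ≤ (sh e).step ∧
      (sh (absorbed X Y)).step ≤ max (X.reach (dictWT sh R C.n₁)) (Y.reach (dictWT sh R C.n₁)) := by
  simp only [ConsistentTH] at hc
  obtain ⟨hX, hY, -, hx, -, hy, -, -⟩ := hc
  have hrX := ConsistentTH.rootStep_le_reach hX
  have hrY := ConsistentTH.rootStep_le_reach hY
  unfold absorbed
  split_ifs
  · rw [(ConsistentTH.root_spec hY).2]
    exact ⟨(ConsistentTH.root_spec hY).1, hy, hrY.trans (le_max_right _ _)⟩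
  · rw [(ConsistentTH.root_spec hX).2]
    exact ⟨(ConsistentTH.root_spec hX).1, hx, hrX.trans (le_max_left _ _)⟩

/-- **DOWNGRADE**: a consistent structure whose (true) reach is at most the horizon `K − D` contains no late merger and no
post-horizon renewal — it is `ConsistentT` (reaches grow along sub-structures). [folklore] -/
theorem ConsistentTH.consistentT_of_reach_le :
    ∀ {G : Gen ε}, ConsistentTH sh C K R D G → G.reach (dictWT sh R C.n₁) ≤ K - D → ConsistentT sh C K R G
  | Gen.born b j, hc, _ => by
      simp only [ConsistentTH] at hc
      simp only [ConsistentT]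
      exact hc
  | Gen.renew G e h, hc, hle => by
      simp only [ConsistentTH] at hc
      obtain ⟨hG, hk, hs, hr, hK⟩ := hc
      simp only [Gen.reach_renew] at hle
      have ih := ConsistentTH.consistentT_of_reach_le hG (by omega)
      simp only [ConsistentT]
      exact ⟨ih, hk, hs, hr, by omega⟩
  | Gen.merge X Y e, hc, hle => by
      simp only [ConsistentTH] at hc
      obtain ⟨hX, hY, hk, hx, hx', hy, hy', htK⟩ := hc
      simp only [Gen.reach_merge] at hle
      have ihX := ConsistentTH.consistentT_of_reach_le hX (by omega)
      have ihY := ConsistentTH.consistentT_of_reach_le hY (by omega)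
      simp only [ConsistentT]
      exact ⟨ihX, ihY, hk, hx, by omega, hy, by omega, htK⟩

/-- a consistent renewal renews a structure ending by the horizon, so the renewed structure is `ConsistentT`.
[folklore] -/
theorem ConsistentTH.renew_consistentT {G : Gen ε} {e : ε} {h : ℕ}
    (hc : ConsistentTH sh C K R D (Gen.renew G e h)) : ConsistentT sh C K R (Gen.renew G e h) := by
  have hc' := hc
  simp only [ConsistentTH] at hc'
  obtain ⟨hG, hk, hs, hr, hK⟩ := hc'
  have hGT := ConsistentTH.consistentT_of_reach_le hG (by omega)
  simp only [ConsistentT]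
  exact ⟨hGT, hk, hs, hr, by omega⟩

/-- **TIGHTNESS AT `D = 0`**: `ConsistentTH sh C K R 0 = ConsistentT sh C K R` (an overdue partner would need
`K < reach`, which with `t ≤ K` is the pending clause again). [folklore] -/
theorem consistentTH_zero_iff : ∀ {G : Gen ε}, ConsistentTH sh C K R 0 G ↔ ConsistentT sh C K R G
  | Gen.born b j => by simp only [ConsistentTH, ConsistentT]
  | Gen.renew G e h => by
      simp only [ConsistentTH, ConsistentT, Nat.sub_zero, consistentTH_zero_iff (G := G)]
  | Gen.merge X Y e => by
      simp only [ConsistentTH, ConsistentT, Nat.sub_zero, consistentTH_zero_iff (G := X),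
        consistentTH_zero_iff (G := Y)]
      constructor
      · rintro ⟨hX, hY, hk, hx, hx', hy, hy', htK⟩
        exact ⟨hX, hY, hk, hx, by omega, hy, by omega, htK⟩
      · rintro ⟨hX, hY, hk, hx, hx', hy, hy', htK⟩
        exact ⟨hX, hY, hk, hx, Or.inl hx', hy, Or.inl hy', htK⟩

end Pad

/-! ## §2 Freshness; well-formedness for the true table and over the padded lives -/

section Fresh

variable {ε : Type*} [DecidableEq ε]

/-- **FRESHNESS**: every event label is new where it is chained and the two partners of a merger carry disjoint label
sets — the label-distinctness half of `Gen.WF` (its timing half is DERIVED below from consistency, over the padded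
lives).  This is what the (ID) owner supplies about labels. [folklore] -/
def FreshT : Gen ε → Prop
  | Gen.born _ _ => True
  | Gen.renew G e _ => FreshT G ∧ e ∉ G.events
  | Gen.merge X Y e => FreshT X ∧ FreshT Y ∧ e ∉ X.events ∧ e ∉ Y.events ∧ Disjoint X.events Y.events

/-- a well-formed genealogy (for any table) is fresh. [folklore] -/
theorem FreshT.of_wf (W : ε → ℕ) : ∀ {G : Gen ε}, G.WF W → FreshT G
  | Gen.born _ _, _ => by simp [FreshT]
  | Gen.renew G e h, hW => by
      simp only [Gen.WF] at hW
      simp only [FreshT]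
      exact ⟨FreshT.of_wf W hW.1, hW.2.1⟩
  | Gen.merge X Y e, hW => by
      simp only [Gen.WF] at hW
      obtain ⟨hX, hY, heX, heY, hd, -, -⟩ := hW
      simp only [FreshT]
      exact ⟨FreshT.of_wf W hX, FreshT.of_wf W hY, heX, heY, hd⟩

variable {sh : ε → PEv} {C : T4PrintedShapeBanking.Consts} {K : ℕ} {R : ℕ → ℕ} {D : ℕ}

/-- a `ConsistentT`, fresh genealogy is well formed for the TRUE table (timing from consistency). [folklore] -/
theorem wf_of_consistentT_freshT :
    ∀ {G : Gen ε}, ConsistentT sh C K R G → FreshT G → G.WF (dictWT sh R C.n₁)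
  | Gen.born _ _, _, _ => by simp [Gen.WF]
  | Gen.renew G e h, hc, hf => by
      simp only [ConsistentT] at hc
      obtain ⟨hG, -, -, hr, -⟩ := hc
      simp only [FreshT] at hf
      have hlt := ConsistentTH.rootStep_lt_reach (consistentTH_zero_iff.2 hG)
      simp only [Gen.WF]
      exact ⟨wf_of_consistentT_freshT hG hf.1, hf.2, by omega, by omega⟩
  | Gen.merge X Y e, hc, hf => by
      simp only [ConsistentT] at hc
      obtain ⟨hX, hY, -, hx, hx', hy, hy', -⟩ := hc
      simp only [FreshT] at hf
      obtain ⟨hfX, hfY, heX, heY, hd⟩ := hf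
      simp only [Gen.WF]
      exact ⟨wf_of_consistentT_freshT hX hfX, wf_of_consistentT_freshT hY hfY, heX, heY, hd, by omega, by omega⟩

/-- **WELL-FORMEDNESS OVER THE PADDED LIVES**: a consistent (late mergers allowed), fresh genealogy is `Gen.WF` for the
PADDED table — an overdue partner's padded life `[rootStep, reach + D)` still contains the merger step `t ≤ K`.
[folklore] -/
theorem ConsistentTH.wf_padW :
    ∀ {G : Gen ε}, ConsistentTH sh C K R D G → FreshT G → G.WF (padW (dictWT sh R C.n₁) D)
  | Gen.born _ _, _, _ => by simp [Gen.WF]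
  | Gen.renew G e h, hc, hf => by
      simp only [ConsistentTH] at hc
      obtain ⟨hG, -, -, hr, -⟩ := hc
      simp only [FreshT] at hf
      have hlt := ConsistentTH.rootStep_lt_reach hG
      have hp := reach_le_reach_padW (dictWT sh R C.n₁) D G
      simp only [Gen.WF]
      exact ⟨ConsistentTH.wf_padW hG hf.1, hf.2, by omega, by omega⟩
  | Gen.merge X Y e, hc, hf => by
      simp only [ConsistentTH] at hc
      obtain ⟨hX, hY, -, hx, hx', hy, hy', htK⟩ := hc
      simp only [FreshT] at hf
      obtain ⟨hfX, hfY, heX, heY, hd⟩ := hf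
      have hpX := reach_add_le_reach_padW (dictWT sh R C.n₁) D X
      have hpY := reach_add_le_reach_padW (dictWT sh R C.n₁) D Y
      simp only [Gen.WF]
      exact ⟨ConsistentTH.wf_padW hX hfX, ConsistentTH.wf_padW hY hfY, heX, heY, hd, by omega, by omega⟩

end Fresh

end

end Summit.QuantumFields.BalabanUV.T4Continuum.LateMergers
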